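import Literature.NumberTheory.IwasawaTheory.ClassGroupPRankSmallRankCriterion
import Literature.NumberTheory.EllipticCurves.FineSelmerTorsionPointFieldMuRoad
import Literature.NumberTheory.EllipticCurves.FineSelmerClassGroupPRankBoundedProofs
import Literature.NumberTheory.EllipticCurves.DivisionFieldUnipotentStabilizer
import Literature.NumberTheory.EllipticCurves.FineSelmerLimThm35Proofs
import HarnessLib

/-!
# Coates–Sujatha's statement (A) from ONE small `p`-rank: doors fed by the one-layer criterion
# `rank_p Cl(F_{n+j}) < p^j - 1` at `F = K(E[p])`, `F = K(P)` (tame) and `F = ℚ(E[p])^{U_P}` (proved)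

`Proofs`-style file (theorems only: no definition, no named fact, no `sorry`) in topic `NumberTheory/EllipticCurves`,
written by the literature seat `bsd-potss-conjA-anchor` g20 (cell `bsd-potss`; serves the asides stmt-BirchSwinnertonDyer-19386 /
19413 and the record lanes k9-c4 / k8t-c4; closes nothing; (A) is proved for no particular curve — the per-row inputs remain displayed
hypotheses).  Namespaces `Literature.NumberTheory.EllipticCurves.CoatesSujatha2005` (§1, §2) and `…Lim2017` (§3).

THE INPUT (sibling `IwasawaTheory/ClassGroupPRankSmallRankCriterion`): for a `ℤ_p`-extension `κ_F` of a number field `F` with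
`TotallyRamifiedFrom κ_F n₀`, `n₀ ≤ n` and `rank_p Cl(F_{n+j}) < p^j - 1` for ONE `j`, the `p`-ranks of all layers are bounded
(`exists_forall_classGroupPRank_le_of_lt_pow_sub_one`) and `μ(κ_F) = 0` (`classicalMuVanishes_of_lt_pow_sub_one`).  THE DOORS:
* §1 `F = K(E[p])` (Coates–Sujatha Thm. 3.4, bounded-rank form `fineSelmerDual_moduleFinite_of_classGroupPRank_le`):
  `conjA_of_classGroupPRank_divisionField_lt_pow_sub_one`;
* §2 `F = K(P)`, `E[p]` irreducible and tame (the seat's Door L8, `fineSelmerDual_moduleFinite_of_classGroupPRank_stabilizerField_le`):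
  `conjA_of_classGroupPRank_stabilizerField_lt_pow_sub_one`;
* §3 `F = ℚ(E[p])^{U_P}` (`K = ℚ`; Lim 2017 Thm. 3.5, tree `thm35_…_holds`, with the structural index hypothesis of
  `DivisionFieldUnipotentStabilizer`): `Lim2017.fineSelmerDual_moduleFinite_of_classGroupPRank_lt_pow_sub_one_unipotentStabilizerField`.
For `p = 3`, `n = n₀`, `j = 1` each door reads: **total ramification from `n₀` and `rank₃ Cl(F_{n₀+1}) ≤ 1` ⟹ (A)** — ONE class group of
ONE layer, and growth `rank 0 → 1` between layers `n₀` and `n₀ + 1` (inconclusive for Fukuda's test) is allowed; `j = 2`: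
`rank₃ Cl(F_{n₀+2}) ≤ 7`.  For `p = 5`, `j = 1`: `rank₅ Cl(F_{n₀+1}) ≤ 3`.

References: [CoatesSujatha2005] Thm. 3.4, Lemma 3.8; [Lim2017FineSelmer] §3 Thm. 3.5, Lemma 3.2; [DeoRaySujatha2023] §5 Lemma 5.1;
[Washington1997] §13.3 Lemma 13.18, Prop. 13.22–13.23; [Fukuda1994] Thm. 1; [Lang1990] Ch. 13 §1
Lemma 3 (the asymptotic form `rank_p V_n = r₁(V) pⁿ + O(1)` of which the one-layer criterion is an effective finite-level reading).
-/

set_option autoImplicit false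

noncomputable section

open scoped Classical NumberField
open NumberField Field IntermediateField

namespace Literature.NumberTheory.EllipticCurves.CoatesSujatha2005

open WeierstrassCurve Literature.NumberTheory.IwasawaTheory Literature.NumberTheory.GaloisRepresentations
  Literature.NumberTheory.EllipticCurves Literature.NumberTheory.EllipticCurves.ZpExtension

variable {K : Type} [Field K] [NumberField K] (W : WeierstrassCurve K) [W.IsElliptic] {p : ℕ} [Fact p.Prime]

/-! ## §1 At the division field `K(E[p])` -/

/-- **(A) from ONE small `p`-rank along the cyclotomic tower of `K(E[p])`** (Coates–Sujatha Thm. 3.4 ∘ the one-layer criterion):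
`p` odd; if SOME cyclotomic `ℤ_p`-extension `κ_L` of `L = K(E[p])` is totally ramified above the ramified primes from layer `n₀`, and
`rank_p Cl(L_{n+j}) < p^j - 1` for some `n ≥ n₀` and `j`, then statement (A) holds for `E` at `p` over `K_∞`.
[cite: CoatesSujatha2005, Thm. 3.4] [cite: Washington1997, §13.3 Prop. 13.22–13.23] [cite: Fukuda1994, Thm. 1 (proof, p. 264)] -/
theorem conjA_of_classGroupPRank_divisionField_lt_pow_sub_one (hp : p ≠ 2) {n₀ n j : ℕ} (hn : n₀ ≤ n)
    (h : haveI : NeZero p := ⟨(Fact.out : p.Prime).ne_zero⟩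
      ∃ κL : ZpExtension ↥(W.divisionField p) p,
        κL.IsCyclotomic ∧ TotallyRamifiedFrom κL n₀ ∧ classGroupPRank κL (n + j) < p ^ j - 1)
    (κ : ZpExtension K p) (hκ : κ.IsCyclotomic) :
    ∃ (γ : absoluteGaloisGroup K) (D : W.FineSelmerDualData κ γ),
      Module.Finite ℤ_[p] (RestrictScalars ℤ_[p] (IwasawaAlgebra p) D.X) := by
  haveI : NeZero p := ⟨(Fact.out : p.Prime).ne_zero⟩
  haveI : NumberField (W.divisionField p) := NumberField.of_module_finite K _
  obtain ⟨κL, hκL, hram, hsmall⟩ := h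
  obtain ⟨B, hB⟩ := exists_forall_classGroupPRank_le_of_lt_pow_sub_one κL hram hn hsmall
  exact fineSelmerDual_moduleFinite_of_classGroupPRank_le W hp κ hκ B ⟨κL, hκL, hB⟩

/-- **The same with the datum displayed for EVERY cyclotomic `ℤ_p`-extension of `K(E[p])`** (the record lanes' hypothesis shape; a
cyclotomic `ℤ_p`-extension of `K(E[p])` exists — the shifted base change of `κ`). [cite: CoatesSujatha2005, Thm. 3.4]
[cite: Washington1997, §13.3 Prop. 13.22–13.23] -/
theorem conjA_of_forall_classGroupPRank_divisionField_lt_pow_sub_one (hp : p ≠ 2) {n₀ n j : ℕ} (hn : n₀ ≤ n)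
    (h : haveI : NeZero p := ⟨(Fact.out : p.Prime).ne_zero⟩
      ∀ κL : ZpExtension ↥(W.divisionField p) p,
        κL.IsCyclotomic → TotallyRamifiedFrom κL n₀ ∧ classGroupPRank κL (n + j) < p ^ j - 1)
    (κ : ZpExtension K p) (hκ : κ.IsCyclotomic) :
    ∃ (γ : absoluteGaloisGroup K) (D : W.FineSelmerDualData κ γ),
      Module.Finite ℤ_[p] (RestrictScalars ℤ_[p] (IwasawaAlgebra p) D.X) := by
  haveI : NeZero p := ⟨(Fact.out : p.Prime).ne_zero⟩
  haveI : NumberField (W.divisionField p) := NumberField.of_module_finite K _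
  obtain ⟨a, κ', hs⟩ := exists_zpExtension_shift κ ↥(W.divisionField p)
  have hκ' : κ'.IsCyclotomic := isCyclotomic_of_shift κ _ κ' hs hκ
  exact conjA_of_classGroupPRank_divisionField_lt_pow_sub_one W hp hn ⟨κ', hκ', (h κ' hκ').1, (h κ' hκ').2⟩ κ hκ

/-- **Exponent form** (`rank_p Cl ≤ ord_p h`, Washington §13.3): `p` odd; if every cyclotomic `ℤ_p`-extension `κ_L` of
`L = K(E[p])` has `TotallyRamifiedFrom κ_L n₀` and `ord_p h(L_{n+j}) < p^j - 1` for some `n ≥ n₀` and `j`, then (A) holds for `E` at `p`.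
[cite: CoatesSujatha2005, Thm. 3.4] [cite: Washington1997, §13.3 Prop. 13.22–13.23 (with `e_n ≥ rank A_n`)] -/
theorem conjA_of_forall_classNumberPExp_divisionField_lt_pow_sub_one (hp : p ≠ 2) {n₀ n j : ℕ} (hn : n₀ ≤ n)
    (h : haveI : NeZero p := ⟨(Fact.out : p.Prime).ne_zero⟩
      ∀ κL : ZpExtension ↥(W.divisionField p) p,
        κL.IsCyclotomic → TotallyRamifiedFrom κL n₀ ∧ classNumberPExp κL (n + j) < p ^ j - 1)
    (κ : ZpExtension K p) (hκ : κ.IsCyclotomic) :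
    ∃ (γ : absoluteGaloisGroup K) (D : W.FineSelmerDualData κ γ),
      Module.Finite ℤ_[p] (RestrictScalars ℤ_[p] (IwasawaAlgebra p) D.X) := by
  haveI : NeZero p := ⟨(Fact.out : p.Prime).ne_zero⟩
  haveI : NumberField (W.divisionField p) := NumberField.of_module_finite K _
  exact conjA_of_forall_classGroupPRank_divisionField_lt_pow_sub_one W hp hn
    (fun κL hκL => ⟨(h κL hκL).1, lt_of_le_of_lt (classGroupPRank_le_classNumberPExp κL _) (h κL hκL).2⟩) κ hκ

/-- **Layer `n₀ + 1`, exponent form — the census shape**: `p` odd; if every cyclotomic `ℤ_p`-extension `κ_L` of `L = K(E[p])` has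
`TotallyRamifiedFrom κ_L n₀` and `ord_p h(L_{n₀+1}) ≤ p - 2` (`p = 3`: `ord₃ h(L_{n₀+1}) ≤ 1`, so `3^0 → 3^1` growth is allowed;
`p = 5`: `ord₅ h ≤ 3`), then (A) holds for `E` at `p` over `K_∞`.
[cite: CoatesSujatha2005, Thm. 3.4] [cite: Washington1997, §13.3 Prop. 13.22–13.23] [cite: Fukuda1994, Thm. 1 (proof, p. 264)] -/
theorem conjA_of_forall_classNumberPExp_divisionField_succ_le (hp : p ≠ 2) {n₀ : ℕ}
    (h : haveI : NeZero p := ⟨(Fact.out : p.Prime).ne_zero⟩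
      ∀ κL : ZpExtension ↥(W.divisionField p) p,
        κL.IsCyclotomic → TotallyRamifiedFrom κL n₀ ∧ classNumberPExp κL (n₀ + 1) ≤ p - 2)
    (κ : ZpExtension K p) (hκ : κ.IsCyclotomic) :
    ∃ (γ : absoluteGaloisGroup K) (D : W.FineSelmerDualData κ γ),
      Module.Finite ℤ_[p] (RestrictScalars ℤ_[p] (IwasawaAlgebra p) D.X) := by
  haveI : NeZero p := ⟨(Fact.out : p.Prime).ne_zero⟩
  have hp1 : p - 2 < p ^ 1 - 1 := by have := (Fact.out : p.Prime).two_le; rw [pow_one]; omega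
  exact conjA_of_forall_classNumberPExp_divisionField_lt_pow_sub_one W hp (n := n₀) (j := 1) le_rfl
    (fun κL hκL => ⟨(h κL hκL).1, lt_of_le_of_lt (h κL hκL).2 hp1⟩) κ hκ

/-! ## §2 At the torsion-point field `K(P)` (`E[p]` irreducible and tame) -/

/-- **(A) from ONE small `p`-rank along the cyclotomic tower of `K(P)`** (the seat's Door L8 ∘ the one-layer criterion): `p` odd,
`E[p]` irreducible and tame (`p ∤ #Gal(K(E[p])/K)`), `P ∈ E[p] ∖ 0`, `K(P) = K̄^{Stab(P)}`; if every (equivalently one) cyclotomic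
`ℤ_p`-extension `κ_P` of `K(P)` has `TotallyRamifiedFrom κ_P n₀` and `rank_p Cl(K(P)_{n+j}) < p^j - 1` (`n ≥ n₀`), then (A) holds for `E`
at `p`.  `K = ℚ`, `p = 3`, normaliser-of-Cartan rows (`n₀ = 0`): `rank₃ Cl(ℚ(P)·ℚ₁) ≤ 1` (ONE degree-`24` class group) suffices.
[cite: CoatesSujatha2005, §3 Lemma 3.8 and Thm. 3.4] [cite: DeoRaySujatha2023, §5 Lemma 5.1] [cite: Washington1997, §13.3 Prop. 13.22–13.23] -/
theorem conjA_of_classGroupPRank_stabilizerField_lt_pow_sub_one (hp : p ≠ 2) (hirr : W.HasIrreducibleModPGaloisRep p)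
    (hG : haveI : NeZero p := ⟨(Fact.out : p.Prime).ne_zero⟩
      ¬ p ∣ Nat.card ((W.divisionField p) ≃ₐ[K] (W.divisionField p)))
    (P : ↥(W.geomTorsion (p : ℤ))) (hP0 : P ≠ 0) {n₀ n j : ℕ} (hn : n₀ ≤ n)
    (h : ∀ κP : ZpExtension ↥(fixedField (MulAction.stabilizer (absoluteGaloisGroup K) P) :
        IntermediateField K (AlgebraicClosure K)) p,
      κP.IsCyclotomic → TotallyRamifiedFrom κP n₀ ∧ classGroupPRank κP (n + j) < p ^ j - 1)
    (κ : ZpExtension K p) (hκ : κ.IsCyclotomic) :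
    ∃ (γ : absoluteGaloisGroup K) (D : W.FineSelmerDualData κ γ),
      Module.Finite ℤ_[p] (RestrictScalars ℤ_[p] (IwasawaAlgebra p) D.X) := by
  have hpr : p.Prime := Fact.out
  haveI : NeZero p := ⟨hpr.ne_zero⟩
  haveI : Finite ↥(W.geomTorsion (p : ℤ)) := W.finite_geomTorsion_nat hpr.ne_zero
  haveI : ContinuousSMul (absoluteGaloisGroup K) ↥(W.geomTorsion (p : ℤ)) :=
    WeierstrassCurve.continuousSMul_geomTorsion W (WeierstrassCurve.isOpen_stabilizer_point_holds W) (p : ℤ)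
  set SP : Subgroup (absoluteGaloisGroup K) := MulAction.stabilizer (absoluteGaloisGroup K) P with hSP
  have hSPopen : IsOpen (SP : Set (absoluteGaloisGroup K)) := stabilizer_isOpen (absoluteGaloisGroup K) P
  set KP : IntermediateField K (AlgebraicClosure K) := fixedField SP with hKP
  haveI : FiniteDimensional K KP := finiteDimensional_fixedField_of_isOpen SP hSPopen
  haveI : NumberField KP := NumberField.of_module_finite K KP
  obtain ⟨a, κ', hs⟩ := exists_zpExtension_shift κ ↥KP
  have hκ' : κ'.IsCyclotomic := isCyclotomic_of_shift κ ↥KP κ' hs hκ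
  obtain ⟨B, hB⟩ := exists_forall_classGroupPRank_le_of_lt_pow_sub_one κ' (h κ' hκ').1 hn (h κ' hκ').2
  exact fineSelmerDual_moduleFinite_of_classGroupPRank_stabilizerField_le W hp hirr hG P hP0 κ hκ B ⟨κ', hκ', hB⟩

/-- **Exponent form at `K(P)`**: as `conjA_of_classGroupPRank_stabilizerField_lt_pow_sub_one` with `ord_p h(K(P)_{n+j}) < p^j - 1`
in place of the `p`-rank (`rank_p Cl ≤ ord_p h`). [cite: CoatesSujatha2005, §3 Lemma 3.8 and Thm. 3.4] [cite: DeoRaySujatha2023, §5 Lemma 5.1]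
[cite: Washington1997, §13.3 Prop. 13.22–13.23] -/
theorem conjA_of_classNumberPExp_stabilizerField_lt_pow_sub_one (hp : p ≠ 2) (hirr : W.HasIrreducibleModPGaloisRep p)
    (hG : haveI : NeZero p := ⟨(Fact.out : p.Prime).ne_zero⟩
      ¬ p ∣ Nat.card ((W.divisionField p) ≃ₐ[K] (W.divisionField p)))
    (P : ↥(W.geomTorsion (p : ℤ))) (hP0 : P ≠ 0) {n₀ n j : ℕ} (hn : n₀ ≤ n)
    (h : ∀ κP : ZpExtension ↥(fixedField (MulAction.stabilizer (absoluteGaloisGroup K) P) :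
        IntermediateField K (AlgebraicClosure K)) p,
      κP.IsCyclotomic → TotallyRamifiedFrom κP n₀ ∧ classNumberPExp κP (n + j) < p ^ j - 1)
    (κ : ZpExtension K p) (hκ : κ.IsCyclotomic) :
    ∃ (γ : absoluteGaloisGroup K) (D : W.FineSelmerDualData κ γ),
      Module.Finite ℤ_[p] (RestrictScalars ℤ_[p] (IwasawaAlgebra p) D.X) := by
  have hpr : p.Prime := Fact.out
  haveI : NeZero p := ⟨hpr.ne_zero⟩
  haveI : Finite ↥(W.geomTorsion (p : ℤ)) := W.finite_geomTorsion_nat hpr.ne_zero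
  haveI : ContinuousSMul (absoluteGaloisGroup K) ↥(W.geomTorsion (p : ℤ)) :=
    WeierstrassCurve.continuousSMul_geomTorsion W (WeierstrassCurve.isOpen_stabilizer_point_holds W) (p : ℤ)
  set SP : Subgroup (absoluteGaloisGroup K) := MulAction.stabilizer (absoluteGaloisGroup K) P with hSP
  have hSPopen : IsOpen (SP : Set (absoluteGaloisGroup K)) := stabilizer_isOpen (absoluteGaloisGroup K) P
  set KP : IntermediateField K (AlgebraicClosure K) := fixedField SP with hKP
  haveI : FiniteDimensional K KP := finiteDimensional_fixedField_of_isOpen SP hSPopen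
  haveI : NumberField KP := NumberField.of_module_finite K KP
  exact conjA_of_classGroupPRank_stabilizerField_lt_pow_sub_one W hp hirr hG P hP0 hn
    (fun κP hκP => ⟨(h κP hκP).1, lt_of_le_of_lt (classGroupPRank_le_classNumberPExp κP _) (h κP hκP).2⟩) κ hκ

/-- **Layer `n₀ + 1` at `K(P)`, exponent form — the census shape**: `p` odd, `E[p]` irreducible and tame, `P ≠ 0`; if every cyclotomic
`ℤ_p`-extension `κ_P` of `K(P)` has `TotallyRamifiedFrom κ_P n₀` and `ord_p h(K(P)_{n₀+1}) ≤ p - 2`, then (A) holds for `E` at `p`.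
`K = ℚ`, `p = 3`, normaliser-of-Cartan rows, `n₀ = 0`: **`ord₃ h(ℚ(P)·ℚ₁) ≤ 1` ⟹ (A)** — in particular the rows
`ord₃ h(ℚ(P)) = 0`, `ord₃ h(ℚ(P)·ℚ₁) = 1` («GROWS», undecided by Fukuda's two-layer test at `(0,1)`) ARE decided at layer `1`.
[cite: CoatesSujatha2005, §3 Lemma 3.8 and Thm. 3.4] [cite: DeoRaySujatha2023, §5 Lemma 5.1] [cite: Washington1997, §13.3 Prop. 13.22–13.23]
[cite: Fukuda1994, Thm. 1 (proof, p. 264)] -/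
theorem conjA_of_classNumberPExp_stabilizerField_succ_le (hp : p ≠ 2) (hirr : W.HasIrreducibleModPGaloisRep p)
    (hG : haveI : NeZero p := ⟨(Fact.out : p.Prime).ne_zero⟩
      ¬ p ∣ Nat.card ((W.divisionField p) ≃ₐ[K] (W.divisionField p)))
    (P : ↥(W.geomTorsion (p : ℤ))) (hP0 : P ≠ 0) {n₀ : ℕ}
    (h : ∀ κP : ZpExtension ↥(fixedField (MulAction.stabilizer (absoluteGaloisGroup K) P) :
        IntermediateField K (AlgebraicClosure K)) p,
      κP.IsCyclotomic → TotallyRamifiedFrom κP n₀ ∧ classNumberPExp κP (n₀ + 1) ≤ p - 2)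
    (κ : ZpExtension K p) (hκ : κ.IsCyclotomic) :
    ∃ (γ : absoluteGaloisGroup K) (D : W.FineSelmerDualData κ γ),
      Module.Finite ℤ_[p] (RestrictScalars ℤ_[p] (IwasawaAlgebra p) D.X) := by
  have hp1 : p - 2 < p ^ 1 - 1 := by have := (Fact.out : p.Prime).two_le; rw [pow_one]; omega
  exact conjA_of_classNumberPExp_stabilizerField_lt_pow_sub_one W hp hirr hG P hP0 (n := n₀) (j := 1) le_rfl
    (fun κP hκP => ⟨(h κP hκP).1, lt_of_le_of_lt (h κP hκP).2 hp1⟩) κ hκ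

end Literature.NumberTheory.EllipticCurves.CoatesSujatha2005

/-! ## §3 At Lim's field `ℚ(E[p])^{U_P}` (`K = ℚ`; any image) -/

namespace Literature.NumberTheory.EllipticCurves.Lim2017

open WeierstrassCurve Literature.NumberTheory.IwasawaTheory IsDedekindDomain NumberField
open Literature.NumberTheory.GaloisRepresentations Literature.NumberTheory.EllipticCurves

/-- A subfield of the (finite) division field is finite over `ℚ` (bookkeeping). [folklore] -/
private theorem finiteDimensional_of_le_divisionField'' (W : WeierstrassCurve ℚ) [W.IsElliptic] (p : ℕ)
    [NeZero p] {L : IntermediateField ℚ (AlgebraicClosure ℚ)} (hL : L ≤ W.divisionField p) :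
    FiniteDimensional ℚ L :=
  FiniteDimensional.of_injective (IntermediateField.inclusion hL).toLinearMap
    (IntermediateField.inclusion_injective hL)

/-- **(A) from ONE small `p`-rank along the cyclotomic tower of `L_P = ℚ(E[p])^{U_P}`** (Lim 2017 Thm. 3.5, tree theorem
`thm35_…_holds`, its index hypothesis structural, ∘ the one-layer criterion): `p` odd, ANY `P ∈ E[p]` (for `P ≠ 0`, `L_P = ℚ(P, μ_p)`,
degree `16` on a `GL₂(𝔽₃)`-image curve); if every cyclotomic `ℤ_p`-extension `κ_L` of `L_P` has `TotallyRamifiedFrom κ_L n₀` and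
`rank_p Cl(L_{P,n+j}) < p^j - 1` (`n ≥ n₀`), then statement (A) holds for `E` at `p`.  `p = 3`, `n = n₀ = 0`, `j = 1`:
`rank₃ Cl(L_{P,1}) ≤ 1` — so the rows with `ord₃ h(L_P) = 0 → ord₃ h(L_{P,1}) = 1` («GROWS» for Fukuda at layers `(0,1)`) are decided at
layer `1`, without the three degree-`72` class groups of layer `2`.  NO image hypothesis.
[cite: Lim2017FineSelmer, §3 Thm. 3.5 and Lemma 3.2 (arXiv:1306.2047 pp. 6–7)] [cite: Washington1997, §13.3 Prop. 13.22–13.23]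
[cite: Fukuda1994, Thm. 1 (proof, p. 264)] -/
theorem fineSelmerDual_moduleFinite_of_classGroupPRank_lt_pow_sub_one_unipotentStabilizerField
    (W : WeierstrassCurve ℚ) [W.IsElliptic] (p : ℕ) [Fact p.Prime] (hp : p ≠ 2) (P : ↥(W.geomTorsion (p : ℤ))) {n₀ n j : ℕ}
    (hn : n₀ ≤ n)
    (h : haveI : NeZero p := ⟨(Fact.out : p.Prime).ne_zero⟩
      ∀ κL : ZpExtension (W.unipotentStabilizerField p P) p, κL.IsCyclotomic →
        TotallyRamifiedFrom κL n₀ ∧ classGroupPRank κL (n + j) < p ^ j - 1)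
    (κ : ZpExtension ℚ p) (hκ : κ.IsCyclotomic) :
    ∃ (γ : Field.absoluteGaloisGroup ℚ) (D : W.FineSelmerDualData κ γ),
      Module.Finite ℤ_[p] (RestrictScalars ℤ_[p] (IwasawaAlgebra p) D.X) := by
  haveI : NeZero p := ⟨(Fact.out : p.Prime).ne_zero⟩
  have hL := W.unipotentStabilizerField_le_divisionField p P
  haveI : FiniteDimensional ℚ (W.unipotentStabilizerField p P) := finiteDimensional_of_le_divisionField'' W p hL
  haveI : NumberField (W.unipotentStabilizerField p P) := NumberField.mk
  refine thm35_fineSelmerDual_moduleFinite_of_classicalMuVanishes_of_le_divisionField_holds W p hp _ hL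
    (W.exists_finrank_divisionField_eq_pow_mul_finrank_unipotentStabilizerField p P) ?_ κ hκ
  intro κL hκL
  exact classicalMuVanishes_of_lt_pow_sub_one κL (h κL hκL).1 hn (h κL hκL).2

/-- **Exponent form at `ℚ(E[p])^{U_P}`**: as the previous theorem with `ord_p h(L_{P,n+j}) < p^j - 1` in place of the `p`-rank.
[cite: Lim2017FineSelmer, §3 Thm. 3.5 and Lemma 3.2 (arXiv:1306.2047 pp. 6–7)] [cite: Washington1997, §13.3 Prop. 13.22–13.23] -/
theorem fineSelmerDual_moduleFinite_of_classNumberPExp_lt_pow_sub_one_unipotentStabilizerField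
    (W : WeierstrassCurve ℚ) [W.IsElliptic] (p : ℕ) [Fact p.Prime] (hp : p ≠ 2) (P : ↥(W.geomTorsion (p : ℤ))) {n₀ n j : ℕ}
    (hn : n₀ ≤ n)
    (h : haveI : NeZero p := ⟨(Fact.out : p.Prime).ne_zero⟩
      ∀ κL : ZpExtension (W.unipotentStabilizerField p P) p, κL.IsCyclotomic →
        TotallyRamifiedFrom κL n₀ ∧ classNumberPExp κL (n + j) < p ^ j - 1)
    (κ : ZpExtension ℚ p) (hκ : κ.IsCyclotomic) :
    ∃ (γ : Field.absoluteGaloisGroup ℚ) (D : W.FineSelmerDualData κ γ),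
      Module.Finite ℤ_[p] (RestrictScalars ℤ_[p] (IwasawaAlgebra p) D.X) := by
  haveI : NeZero p := ⟨(Fact.out : p.Prime).ne_zero⟩
  have hL := W.unipotentStabilizerField_le_divisionField p P
  haveI : FiniteDimensional ℚ (W.unipotentStabilizerField p P) := finiteDimensional_of_le_divisionField'' W p hL
  haveI : NumberField (W.unipotentStabilizerField p P) := NumberField.mk
  exact fineSelmerDual_moduleFinite_of_classGroupPRank_lt_pow_sub_one_unipotentStabilizerField W p hp P hn
    (fun κL hκL => ⟨(h κL hκL).1, lt_of_le_of_lt (classGroupPRank_le_classNumberPExp κL _) (h κL hκL).2⟩) κ hκ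

/-- **Layer `n₀ + 1` at `ℚ(E[p])^{U_P}`, exponent form — the census shape**: `p` odd, any `P`; if every cyclotomic `ℤ_p`-extension
`κ_L` of `L_P = ℚ(E[p])^{U_P}` has `TotallyRamifiedFrom κ_L n₀` and `ord_p h(L_{P,n₀+1}) ≤ p - 2`, then (A) holds for `E` at `p`.
`p = 3`, `n₀ = 0`: **`ord₃ h(L_{P,1}) ≤ 1` ⟹ (A)** (ONE class group, degree `48` on a `GL₂(𝔽₃)`-image curve), deciding the «GROWS `0 → 1`»
rows of the `U_P`-door census without layer `2`.  NO image hypothesis.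
[cite: Lim2017FineSelmer, §3 Thm. 3.5 and Lemma 3.2 (arXiv:1306.2047 pp. 6–7)] [cite: Washington1997, §13.3 Prop. 13.22–13.23]
[cite: Fukuda1994, Thm. 1 (proof, p. 264)] -/
theorem fineSelmerDual_moduleFinite_of_classNumberPExp_succ_le_unipotentStabilizerField
    (W : WeierstrassCurve ℚ) [W.IsElliptic] (p : ℕ) [Fact p.Prime] (hp : p ≠ 2) (P : ↥(W.geomTorsion (p : ℤ))) {n₀ : ℕ}
    (h : haveI : NeZero p := ⟨(Fact.out : p.Prime).ne_zero⟩
      ∀ κL : ZpExtension (W.unipotentStabilizerField p P) p, κL.IsCyclotomic →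
        TotallyRamifiedFrom κL n₀ ∧ classNumberPExp κL (n₀ + 1) ≤ p - 2)
    (κ : ZpExtension ℚ p) (hκ : κ.IsCyclotomic) :
    ∃ (γ : Field.absoluteGaloisGroup ℚ) (D : W.FineSelmerDualData κ γ),
      Module.Finite ℤ_[p] (RestrictScalars ℤ_[p] (IwasawaAlgebra p) D.X) := by
  have hp1 : p - 2 < p ^ 1 - 1 := by have := (Fact.out : p.Prime).two_le; rw [pow_one]; omega
  exact fineSelmerDual_moduleFinite_of_classNumberPExp_lt_pow_sub_one_unipotentStabilizerField W p hp P (n := n₀) (j := 1)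
    le_rfl (fun κL hκL => ⟨(h κL hκL).1, lt_of_le_of_lt (h κL hκL).2 hp1⟩) κ hκ

end Literature.NumberTheory.EllipticCurves.Lim2017

end
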